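import Summits.BirchSwinnertonDyer.BirchSwinnertonDyer.Theorems.QuadraticBranchSignedControlPlusEtaNonsurjConjADoorUnit
import Summits.BirchSwinnertonDyer.Rank1Residual.X11b.ChaPairsMinimality
import HarnessLib

/-!
# Route `QuadraticBranchSignedControl` (rung K8, cell `bsd-potss`), residual crux `PlusEtaMainConjectureNonsurj`
# (stmt-BirchSwinnertonDyer-19606): UNCONGRUENT UNIT-ROW RECORDS — (C1⁺_η) at `p = 5` BY NAME on the four rank-zero UNIT members
# `D = 8, 13, 17, 61` of the uncongruent family u5a through the unit-row door ∘ door L6⁻ (seat `bsd-potss-k8eta-c2` g22; census k8eta-c2 g21,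
# kit j326613 = E5-FAM-u5a, GRH)

WHAT. The family u5a = the `5`-partners `W_D` of the quadratic twists `A^{(D)}` of `A = [1,−1,1,−4010,98676]` (the `t = 4/5` point of Zywina's
`X_ns⁺(5)` family; non-CM, mod-`5` image `C_ns⁺(5)`, NOT `5`-congruent to any CM row — k8eta-c2 g19 p666083): the domain of v7's hardest stub
`stub_etaMC_nonCM_uncongruent` at `p = 5`. g21's census (kit j326613, engine e5.gp 2e115a13, `bnfinit` cap 6000 s) resolved 22 of 104 members;
four of them are UNIT rows — `ε(W_D) = +1`, PARI plus-`η` `(λ, μ) = (0, 0)` (so `L_5⁺(V,η,T) ∈ Λˣ`), `r_an(W_D) = 0` — with door L6⁻ PASS: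
`D = 8` (`h(ℚ(P)) = 30`), `13` (`120 = [30,2,2]`), `17` (`60 = [30,2]`), `61` (`480 = [30,2,2,2,2]`), all with `h(ℚ(x(P))) = 15`, `v₅ h = 1 ≤ 1 = v₅ hx`
(eigen dimensions `(d₁,d₂,d₃,d₄) = (0,0,0,1)`). g21 left them «non-CM rank-0 shape: needs `MissingLowerBoundAt` — not instantiated»; the
unit-row door (`EtaConjADoorUnit.quadraticBranchPlusEtaMainConjectureAt_of_relClassNumber_of_isUnit`, this seat) needs NO lower bound: this file
instantiates it on the four rows — `etaMC_unit_u5a_{8,13,17,61}_5_of_relClassNumber`. With g21's six prime-`L` rank-one records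
(p703871, p712019) the uncongruent class has TEN rows carried to (C1⁺_η) by name; these four are the first with NO `r_an`/GZK input at all
(inputs: `h22 h41 h6273`, two GRH class numbers, the PARI unit certificate, the tower clause).

HONEST FRAMING (cell `bsd-potss`; FULL-BSD rank ≤ 1 programme, HUMAN RULING D-0036/D-0074): per-row RECORDS, CONDITIONAL on the displayed named
facts (`h22 h41 h6273`) and per-row inputs (the tower clause, the unit certificate «every `L_5⁺(V,η,T)` is a unit», the relative class-number
datum); class numbers / `λ, μ` are GRH resp. numerical values (evidence, not facts); no stub of 19606 is proved by name; the crux stays OPEN;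
nothing is booked; `BSD(W,5)` is claimed for no pair. `--supports stmt-BirchSwinnertonDyer-19606`.

References: [Kobayashi2003] Thm. 2.2 (p. 5), (3.6) (p. 7), §4 (p. 8), Thm. 4.1; [CoatesSujatha2005] §3 (A), Thm. 3.4; [NeukirchANT1999] III §1 (1.6);
[Zywina2015] Thm. 1.4 (the `X_ns⁺(5)` family).
-/

set_option autoImplicit false
set_option linter.dupNamespace false
noncomputable section

open scoped Classical nonZeroDivisors

open CongruenceSubgroup NumberField Field WeierstrassCurve
open Literature.NumberTheory.EllipticCurves Literature.NumberTheory.EllipticCurves.ModularForms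
  Literature.NumberTheory.EllipticCurves.Rank1Residual Literature.NumberTheory.EllipticCurves.Rank1Residual.Typed
  Literature.NumberTheory.GaloisRepresentations Literature.NumberTheory.GaloisCohomology Literature.NumberTheory.NumberFields
  Literature.NumberTheory.EllipticCurves.GreenbergVatsal2000 ZpExtension
open Summit.BirchSwinnertonDyer.Rank1Residual Summit.BirchSwinnertonDyer.Rank1Residual.Additive
open Summit.BirchSwinnertonDyer.Rank1Residual.X11b (isElliptic_of_discOf_ne_zero)
open Summit.BirchSwinnertonDyer.BirchSwinnertonDyer.Theorems
open Summit.BirchSwinnertonDyer.BirchSwinnertonDyer.Theorems.EtaConjADoorUnit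
  (quadraticBranchPlusEtaMainConjectureAt_of_relClassNumber_of_isUnit)

namespace Summit.BirchSwinnertonDyer.BirchSwinnertonDyer.Theorems.EtaConjADoorUnitRecords

/-- The `5`-partner of u5a:8, `W = [0, 0, 0, -6415500, 6251126000]` (non-CM, `N_W = 69854400`; `j(W) = j(A)`, `A = [1,−1,1,−4010,98676]` the `t = 4/5` member of Zywina's
`X_ns⁺(5)` family, twisted by `D = 8`): `Δ ≠ 0` (kernel). [cite: Zywina2015, Thm. 1.4] -/
theorem isElliptic_u5a_8 : (⟨0, 0, 0, (-6415500), 6251126000⟩ : WeierstrassCurve ℚ).IsElliptic :=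
  isElliptic_of_discOf_ne_zero 0 0 0 (-6415500) 6251126000 (by decide +kernel)

/-- **(C1⁺_η) at `p = 5` for every good `a_5 = 0` model `V` of the `5`-twist of the UNCONGRUENT UNIT partner u5a:8** (`W = [0, 0, 0, -6415500, 6251126000]`, non-CM,
`N_W = 69854400`; kit j326613 (493 s, GRH): `ε(W) = +1`, PARI plus-`η` `(λ, μ) = (0, 0)` — `L_5⁺(V,η,T)` is a UNIT —, `r_an(W) = 0` (`ellanalyticrank`);
`h(ℚ(P)) = 30` (`[30]`), `h(ℚ(x(P))) = 15`: `v₅ = 1 ≤ 1` — the plain class-number door is void, door L6⁻ passes) from the ROW ALONE — named facts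
`h22 h41 h6273` ONLY (no `hGZK`, no `r_an`, no `L₀`); displayed: the tower clause, the unit certificate, the relative class-number datum. A row of
v7's `stub_etaMC_nonCM_uncongruent` (no CM curve is `5`-congruent to it, p666083). Instance of
`EtaConjADoorUnit.quadraticBranchPlusEtaMainConjectureAt_of_relClassNumber_of_isUnit` (this seat). CONDITIONAL; nothing booked.
[cite: Kobayashi2003, §4 (p. 8), Thm. 2.2 (p. 5)] [cite: CoatesSujatha2005, §3 (A) and Thm. 3.4] [cite: Zywina2015, Thm. 1.4] -/
theorem etaMC_unit_u5a_8_5_of_relClassNumber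
    (h22 : Kobayashi2003.thm22_etaSignedSelmerDual_finite_torsion)
    (h41 : Kobayashi2003.thm41_plusEtaCharIdeal_dvd)
    (h6273 : Kobayashi2003.thm62_63_73_etaColemanPoitouTate) [Fact (5 : ℕ).Prime]
    (W : WeierstrassCurve ℚ) (hW : W = (⟨0, 0, 0, (-6415500), 6251126000⟩ : WeierstrassCurve ℚ))
    (V : WeierstrassCurve ℚ) [V.IsElliptic] [V.IsGloballyMinimal] (C : VariableChange ℚ)
    (hC : C • W.quadraticTwist 5 = V)
    (hgood : V.HasGoodReductionAtPrime 5) (hap : V.frobeniusTrace 5 = 0)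
    (hns : ¬ ∀ m : ℕ, V.HasSurjectiveModNGaloisRep (5 ^ m : ℕ))
    (hunit : ∀ {N : ℕ} [NeZero N] {f : CuspForm (Gamma0 N) 2}, IsNewformOf V f →
      ∀ (ϖ : ℚ), (if Even (5 / 2) then (ϖ : ℝ) * V.realPeriodRat = plusPeriod f
          else (ϖ : ℝ) * V.imaginaryPeriodRat = minusPeriod f) →
      ∀ (Lη : IwasawaAlgebra 5), IsQuadraticBranchPlusLFunction f 5 ϖ Lη → IsUnit Lη)
    (hP : haveI : W.IsElliptic := hW ▸ isElliptic_u5a_8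
      haveI : NeZero (5 : ℕ) := ⟨by norm_num⟩
      haveI : NumberField (W.divisionField 5) := NumberField.mk
      ∃ P : geomTorsion W ((5 : ℕ) : ℤ), P ≠ 0 ∧ ∀ τ : absoluteGaloisGroup ℚ, τ • P = -P →
        ∀ K : IntermediateField ℚ (W.divisionField 5),
          K = IntermediateField.fixedField
            ((MulAction.stabilizer (absoluteGaloisGroup ℚ) P).map (absRestrictNormalHom (W.divisionField 5))) →
        ∀ σ : K ≃ₐ[ℚ] K,
          (∀ x : K, absRestrictNormalHom (W.divisionField 5) τ (x : W.divisionField 5) =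
            ((σ x : K) : W.divisionField 5)) →
          padicValNat 5 (NumberField.classNumber K) ≤
            padicValNat 5 (NumberField.classNumber (IntermediateField.fixedField (Subgroup.zpowers σ)))) :
    QuadraticBranchPlusEtaMainConjectureAt V 5 := by
  subst hW
  haveI : (⟨0, 0, 0, (-6415500), 6251126000⟩ : WeierstrassCurve ℚ).IsElliptic := isElliptic_u5a_8
  haveI : NeZero (5 : ℕ) := ⟨by norm_num⟩
  exact quadraticBranchPlusEtaMainConjectureAt_of_relClassNumber_of_isUnit 5 V _ C h22 h41 h6273 (le_refl 5)
    (by rw [show ((-1 : ℚ) ^ ((5 : ℕ) / 2) * ((5 : ℕ) : ℚ)) = 5 by norm_num]; exact hC) hgood hap hns hP hunit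

/-- The `5`-partner of u5a:13, `W = [1, -1, 1, -16940930, 26827914572]` (non-CM, `N_W = 184459275`; `j(W) = j(A)`, `A = [1,−1,1,−4010,98676]` the `t = 4/5` member of Zywina's
`X_ns⁺(5)` family, twisted by `D = 13`): `Δ ≠ 0` (kernel). [cite: Zywina2015, Thm. 1.4] -/
theorem isElliptic_u5a_13 : (⟨1, (-1), 1, (-16940930), 26827914572⟩ : WeierstrassCurve ℚ).IsElliptic :=
  isElliptic_of_discOf_ne_zero 1 (-1) 1 (-16940930) 26827914572 (by decide +kernel)

/-- **(C1⁺_η) at `p = 5` for every good `a_5 = 0` model `V` of the `5`-twist of the UNCONGRUENT UNIT partner u5a:13** (`W = [1, -1, 1, -16940930, 26827914572]`, non-CM,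
`N_W = 184459275`; kit j326613 (658 s, GRH): `ε(W) = +1`, PARI plus-`η` `(λ, μ) = (0, 0)` — `L_5⁺(V,η,T)` is a UNIT —, `r_an(W) = 0` (`ellanalyticrank`);
`h(ℚ(P)) = 120` (`[30,2,2]`), `h(ℚ(x(P))) = 15`: `v₅ = 1 ≤ 1` — the plain class-number door is void, door L6⁻ passes) from the ROW ALONE — named facts
`h22 h41 h6273` ONLY (no `hGZK`, no `r_an`, no `L₀`); displayed: the tower clause, the unit certificate, the relative class-number datum. A row of
v7's `stub_etaMC_nonCM_uncongruent` (no CM curve is `5`-congruent to it, p666083). Instance of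
`EtaConjADoorUnit.quadraticBranchPlusEtaMainConjectureAt_of_relClassNumber_of_isUnit` (this seat). CONDITIONAL; nothing booked.
[cite: Kobayashi2003, §4 (p. 8), Thm. 2.2 (p. 5)] [cite: CoatesSujatha2005, §3 (A) and Thm. 3.4] [cite: Zywina2015, Thm. 1.4] -/
theorem etaMC_unit_u5a_13_5_of_relClassNumber
    (h22 : Kobayashi2003.thm22_etaSignedSelmerDual_finite_torsion)
    (h41 : Kobayashi2003.thm41_plusEtaCharIdeal_dvd)
    (h6273 : Kobayashi2003.thm62_63_73_etaColemanPoitouTate) [Fact (5 : ℕ).Prime]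
    (W : WeierstrassCurve ℚ) (hW : W = (⟨1, (-1), 1, (-16940930), 26827914572⟩ : WeierstrassCurve ℚ))
    (V : WeierstrassCurve ℚ) [V.IsElliptic] [V.IsGloballyMinimal] (C : VariableChange ℚ)
    (hC : C • W.quadraticTwist 5 = V)
    (hgood : V.HasGoodReductionAtPrime 5) (hap : V.frobeniusTrace 5 = 0)
    (hns : ¬ ∀ m : ℕ, V.HasSurjectiveModNGaloisRep (5 ^ m : ℕ))
    (hunit : ∀ {N : ℕ} [NeZero N] {f : CuspForm (Gamma0 N) 2}, IsNewformOf V f →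
      ∀ (ϖ : ℚ), (if Even (5 / 2) then (ϖ : ℝ) * V.realPeriodRat = plusPeriod f
          else (ϖ : ℝ) * V.imaginaryPeriodRat = minusPeriod f) →
      ∀ (Lη : IwasawaAlgebra 5), IsQuadraticBranchPlusLFunction f 5 ϖ Lη → IsUnit Lη)
    (hP : haveI : W.IsElliptic := hW ▸ isElliptic_u5a_13
      haveI : NeZero (5 : ℕ) := ⟨by norm_num⟩
      haveI : NumberField (W.divisionField 5) := NumberField.mk
      ∃ P : geomTorsion W ((5 : ℕ) : ℤ), P ≠ 0 ∧ ∀ τ : absoluteGaloisGroup ℚ, τ • P = -P →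
        ∀ K : IntermediateField ℚ (W.divisionField 5),
          K = IntermediateField.fixedField
            ((MulAction.stabilizer (absoluteGaloisGroup ℚ) P).map (absRestrictNormalHom (W.divisionField 5))) →
        ∀ σ : K ≃ₐ[ℚ] K,
          (∀ x : K, absRestrictNormalHom (W.divisionField 5) τ (x : W.divisionField 5) =
            ((σ x : K) : W.divisionField 5)) →
          padicValNat 5 (NumberField.classNumber K) ≤
            padicValNat 5 (NumberField.classNumber (IntermediateField.fixedField (Subgroup.zpowers σ)))) :
    QuadraticBranchPlusEtaMainConjectureAt V 5 := by
  subst hW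
  haveI : (⟨1, (-1), 1, (-16940930), 26827914572⟩ : WeierstrassCurve ℚ).IsElliptic := isElliptic_u5a_13
  haveI : NeZero (5 : ℕ) := ⟨by norm_num⟩
  exact quadraticBranchPlusEtaMainConjectureAt_of_relClassNumber_of_isUnit 5 V _ C h22 h41 h6273 (le_refl 5)
    (by rw [show ((-1 : ℚ) ^ ((5 : ℕ) / 2) * ((5 : ℕ) : ℚ)) = 5 by norm_num]; exact hC) hgood hap hns hP hunit

/-- The `5`-partner of u5a:17, `W = [1, -1, 0, -28969992, 59991191791]` (non-CM, `N_W = 315436275`; `j(W) = j(A)`, `A = [1,−1,1,−4010,98676]` the `t = 4/5` member of Zywina's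
`X_ns⁺(5)` family, twisted by `D = 17`): `Δ ≠ 0` (kernel). [cite: Zywina2015, Thm. 1.4] -/
theorem isElliptic_u5a_17 : (⟨1, (-1), 0, (-28969992), 59991191791⟩ : WeierstrassCurve ℚ).IsElliptic :=
  isElliptic_of_discOf_ne_zero 1 (-1) 0 (-28969992) 59991191791 (by decide +kernel)

/-- **(C1⁺_η) at `p = 5` for every good `a_5 = 0` model `V` of the `5`-twist of the UNCONGRUENT UNIT partner u5a:17** (`W = [1, -1, 0, -28969992, 59991191791]`, non-CM,
`N_W = 315436275`; kit j326613 (638 s, GRH): `ε(W) = +1`, PARI plus-`η` `(λ, μ) = (0, 0)` — `L_5⁺(V,η,T)` is a UNIT —, `r_an(W) = 0` (`ellanalyticrank`);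
`h(ℚ(P)) = 60` (`[30,2]`), `h(ℚ(x(P))) = 15`: `v₅ = 1 ≤ 1` — the plain class-number door is void, door L6⁻ passes) from the ROW ALONE — named facts
`h22 h41 h6273` ONLY (no `hGZK`, no `r_an`, no `L₀`); displayed: the tower clause, the unit certificate, the relative class-number datum. A row of
v7's `stub_etaMC_nonCM_uncongruent` (no CM curve is `5`-congruent to it, p666083). Instance of
`EtaConjADoorUnit.quadraticBranchPlusEtaMainConjectureAt_of_relClassNumber_of_isUnit` (this seat). CONDITIONAL; nothing booked.
[cite: Kobayashi2003, §4 (p. 8), Thm. 2.2 (p. 5)] [cite: CoatesSujatha2005, §3 (A) and Thm. 3.4] [cite: Zywina2015, Thm. 1.4] -/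
theorem etaMC_unit_u5a_17_5_of_relClassNumber
    (h22 : Kobayashi2003.thm22_etaSignedSelmerDual_finite_torsion)
    (h41 : Kobayashi2003.thm41_plusEtaCharIdeal_dvd)
    (h6273 : Kobayashi2003.thm62_63_73_etaColemanPoitouTate) [Fact (5 : ℕ).Prime]
    (W : WeierstrassCurve ℚ) (hW : W = (⟨1, (-1), 0, (-28969992), 59991191791⟩ : WeierstrassCurve ℚ))
    (V : WeierstrassCurve ℚ) [V.IsElliptic] [V.IsGloballyMinimal] (C : VariableChange ℚ)
    (hC : C • W.quadraticTwist 5 = V)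
    (hgood : V.HasGoodReductionAtPrime 5) (hap : V.frobeniusTrace 5 = 0)
    (hns : ¬ ∀ m : ℕ, V.HasSurjectiveModNGaloisRep (5 ^ m : ℕ))
    (hunit : ∀ {N : ℕ} [NeZero N] {f : CuspForm (Gamma0 N) 2}, IsNewformOf V f →
      ∀ (ϖ : ℚ), (if Even (5 / 2) then (ϖ : ℝ) * V.realPeriodRat = plusPeriod f
          else (ϖ : ℝ) * V.imaginaryPeriodRat = minusPeriod f) →
      ∀ (Lη : IwasawaAlgebra 5), IsQuadraticBranchPlusLFunction f 5 ϖ Lη → IsUnit Lη)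
    (hP : haveI : W.IsElliptic := hW ▸ isElliptic_u5a_17
      haveI : NeZero (5 : ℕ) := ⟨by norm_num⟩
      haveI : NumberField (W.divisionField 5) := NumberField.mk
      ∃ P : geomTorsion W ((5 : ℕ) : ℤ), P ≠ 0 ∧ ∀ τ : absoluteGaloisGroup ℚ, τ • P = -P →
        ∀ K : IntermediateField ℚ (W.divisionField 5),
          K = IntermediateField.fixedField
            ((MulAction.stabilizer (absoluteGaloisGroup ℚ) P).map (absRestrictNormalHom (W.divisionField 5))) →
        ∀ σ : K ≃ₐ[ℚ] K,
          (∀ x : K, absRestrictNormalHom (W.divisionField 5) τ (x : W.divisionField 5) =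
            ((σ x : K) : W.divisionField 5)) →
          padicValNat 5 (NumberField.classNumber K) ≤
            padicValNat 5 (NumberField.classNumber (IntermediateField.fixedField (Subgroup.zpowers σ)))) :
    QuadraticBranchPlusEtaMainConjectureAt V 5 := by
  subst hW
  haveI : (⟨1, (-1), 0, (-28969992), 59991191791⟩ : WeierstrassCurve ℚ).IsElliptic := isElliptic_u5a_17
  haveI : NeZero (5 : ℕ) := ⟨by norm_num⟩
  exact quadraticBranchPlusEtaMainConjectureAt_of_relClassNumber_of_isUnit 5 V _ C h22 h41 h6273 (le_refl 5)
    (by rw [show ((-1 : ℚ) ^ ((5 : ℕ) / 2) * ((5 : ℕ) : ℚ)) = 5 by norm_num]; exact hC) hgood hap hns hP hunit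

/-- The `5`-partner of u5a:61, `W = [1, -1, 1, -373001180, 2771356591322]` (non-CM, `N_W = 4061378475`; `j(W) = j(A)`, `A = [1,−1,1,−4010,98676]` the `t = 4/5` member of Zywina's
`X_ns⁺(5)` family, twisted by `D = 61`): `Δ ≠ 0` (kernel). [cite: Zywina2015, Thm. 1.4] -/
theorem isElliptic_u5a_61 : (⟨1, (-1), 1, (-373001180), 2771356591322⟩ : WeierstrassCurve ℚ).IsElliptic :=
  isElliptic_of_discOf_ne_zero 1 (-1) 1 (-373001180) 2771356591322 (by decide +kernel)

/-- **(C1⁺_η) at `p = 5` for every good `a_5 = 0` model `V` of the `5`-twist of the UNCONGRUENT UNIT partner u5a:61** (`W = [1, -1, 1, -373001180, 2771356591322]`, non-CM,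
`N_W = 4061378475`; kit j326613 (1802 s, GRH): `ε(W) = +1`, PARI plus-`η` `(λ, μ) = (0, 0)` — `L_5⁺(V,η,T)` is a UNIT —, `r_an(W) = 0` (`ellanalyticrank`);
`h(ℚ(P)) = 480` (`[30,2,2,2,2]`), `h(ℚ(x(P))) = 15`: `v₅ = 1 ≤ 1` — the plain class-number door is void, door L6⁻ passes) from the ROW ALONE — named facts
`h22 h41 h6273` ONLY (no `hGZK`, no `r_an`, no `L₀`); displayed: the tower clause, the unit certificate, the relative class-number datum. A row of
v7's `stub_etaMC_nonCM_uncongruent` (no CM curve is `5`-congruent to it, p666083). Instance of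
`EtaConjADoorUnit.quadraticBranchPlusEtaMainConjectureAt_of_relClassNumber_of_isUnit` (this seat). CONDITIONAL; nothing booked.
[cite: Kobayashi2003, §4 (p. 8), Thm. 2.2 (p. 5)] [cite: CoatesSujatha2005, §3 (A) and Thm. 3.4] [cite: Zywina2015, Thm. 1.4] -/
theorem etaMC_unit_u5a_61_5_of_relClassNumber
    (h22 : Kobayashi2003.thm22_etaSignedSelmerDual_finite_torsion)
    (h41 : Kobayashi2003.thm41_plusEtaCharIdeal_dvd)
    (h6273 : Kobayashi2003.thm62_63_73_etaColemanPoitouTate) [Fact (5 : ℕ).Prime]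
    (W : WeierstrassCurve ℚ) (hW : W = (⟨1, (-1), 1, (-373001180), 2771356591322⟩ : WeierstrassCurve ℚ))
    (V : WeierstrassCurve ℚ) [V.IsElliptic] [V.IsGloballyMinimal] (C : VariableChange ℚ)
    (hC : C • W.quadraticTwist 5 = V)
    (hgood : V.HasGoodReductionAtPrime 5) (hap : V.frobeniusTrace 5 = 0)
    (hns : ¬ ∀ m : ℕ, V.HasSurjectiveModNGaloisRep (5 ^ m : ℕ))
    (hunit : ∀ {N : ℕ} [NeZero N] {f : CuspForm (Gamma0 N) 2}, IsNewformOf V f →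
      ∀ (ϖ : ℚ), (if Even (5 / 2) then (ϖ : ℝ) * V.realPeriodRat = plusPeriod f
          else (ϖ : ℝ) * V.imaginaryPeriodRat = minusPeriod f) →
      ∀ (Lη : IwasawaAlgebra 5), IsQuadraticBranchPlusLFunction f 5 ϖ Lη → IsUnit Lη)
    (hP : haveI : W.IsElliptic := hW ▸ isElliptic_u5a_61
      haveI : NeZero (5 : ℕ) := ⟨by norm_num⟩
      haveI : NumberField (W.divisionField 5) := NumberField.mk
      ∃ P : geomTorsion W ((5 : ℕ) : ℤ), P ≠ 0 ∧ ∀ τ : absoluteGaloisGroup ℚ, τ • P = -P →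
        ∀ K : IntermediateField ℚ (W.divisionField 5),
          K = IntermediateField.fixedField
            ((MulAction.stabilizer (absoluteGaloisGroup ℚ) P).map (absRestrictNormalHom (W.divisionField 5))) →
        ∀ σ : K ≃ₐ[ℚ] K,
          (∀ x : K, absRestrictNormalHom (W.divisionField 5) τ (x : W.divisionField 5) =
            ((σ x : K) : W.divisionField 5)) →
          padicValNat 5 (NumberField.classNumber K) ≤
            padicValNat 5 (NumberField.classNumber (IntermediateField.fixedField (Subgroup.zpowers σ)))) :
    QuadraticBranchPlusEtaMainConjectureAt V 5 := by
  subst hW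
  haveI : (⟨1, (-1), 1, (-373001180), 2771356591322⟩ : WeierstrassCurve ℚ).IsElliptic := isElliptic_u5a_61
  haveI : NeZero (5 : ℕ) := ⟨by norm_num⟩
  exact quadraticBranchPlusEtaMainConjectureAt_of_relClassNumber_of_isUnit 5 V _ C h22 h41 h6273 (le_refl 5)
    (by rw [show ((-1 : ℚ) ^ ((5 : ℕ) / 2) * ((5 : ℕ) : ℚ)) = 5 by norm_num]; exact hC) hgood hap hns hP hunit

end Summit.BirchSwinnertonDyer.BirchSwinnertonDyer.Theorems.EtaConjADoorUnitRecords

end
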